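import Summits.AtomisticToContinuum.Crystallization.Theorems.FrustratedLawDichotomyStrainedPatchHomValueT2SoundV
import Summits.AtomisticToContinuum.Crystallization.Theorems.FrustratedLawDichotomyStrainedPatchHomValueT2SoundH

/-!
# (I1) part W — ASSEMBLY LEMMAS for `valueLeafT2J_sound` (step 6b): per-label POINT memberships in the kit's point tables (gradient entry `βζ_k`,
# Hessian entry `αζ_kζ_l + βν_kl`, masked for the `A` family), the centre energy floor in near-label form (`valueP_sound` + `boxSum*_eq_nearSum`), the
# folded half-width array, the nonnegativity of the box half-widths under `foldGuard`, the kit's penalty folds as sums, and small real inequalities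
# (27623 `(H) HomFloor`, hcp half; decomp-a2c hand-1 g49; critic row 1674 (B) (I1) docket).

No definitions; 0 sorry; standard axioms; no instances / notation / `#eval`.  `--supports stmt-AtomisticToContinuum-27623`.
-/

noncomputable section

namespace Summit.AtomisticToContinuum.Crystallization.Theorems.FrustratedLawDichotomyStrainedPatchHomValueT2Kit

open scoped BigOperators RealInnerProductSpace
open Finset
open Literature.Analysis.ValidatedNumerics.Numerics
open Summit.AtomisticToContinuum.Crystallization.Theorems.ChargedEnergyGapNegative (E3)
open Summit.AtomisticToContinuum.Crystallization.Theorems.FrustratedLawDichotomySchurCut (effPot w₄₅ ω₄)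
open Summit.AtomisticToContinuum.Crystallization.Theorems.FrustratedLawDichotomyStrainedPatchTaylorLeaves (junctions)
open Summit.AtomisticToContinuum.Crystallization.Theorems.FrustratedLawDichotomyStrainedPatchHomSplit (latPt hexFrame hcpShift)
open Summit.AtomisticToContinuum.Crystallization.Theorems.FrustratedLawDichotomyStrainedPatchHomEntryGramHcp (shufFI)
open Summit.AtomisticToContinuum.Crystallization.Theorems.FrustratedLawDichotomyStrainedPatchHomCurvCentreKit
  (boxE cenE cenX cenMap cenShuf zW cenMap_box cenShuf_box)

/-! ## §1. Small real and fold facts -/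

/-- `|G − g| ≤ r` ⟹ `gδ − r|δ| ≤ Gδ`. [arithmetic] -/
theorem lin_ge {G g r δ : ℝ} (h : |G - g| ≤ r) : g * δ - r * |δ| ≤ G * δ := by
  have h1 : |(G - g) * δ| ≤ r * |δ| := by rw [abs_mul]; exact mul_le_mul_of_nonneg_right h (abs_nonneg _)
  have h2 := neg_abs_le ((G - g) * δ)
  nlinarith

/-- The kit's single penalty fold is a sum. [formal bookkeeping] -/
theorem foldl9_sum (F : ℕ → ℤ) : (List.range 9).foldl (fun s k => s + F k) 0 = ∑ k ∈ range 9, F k := by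
  rw [foldl_add_range, zero_add]

/-- The kit's double penalty fold is a double sum. [formal bookkeeping] -/
theorem foldl99_sum (F : ℕ → ℕ → ℤ) :
    (List.range 9).foldl (fun s k => (List.range 9).foldl (fun s2 l => s2 + F k l) s) 0 = ∑ k ∈ range 9, ∑ l ∈ range 9, F k l := by
  simp only [foldl_add_range, zero_add]

/-! ## §2. Half-widths -/

/-- Reading the folded half-width array below `9`. [formal bookkeeping] -/
theorem wfA_getD (w : (Fin 3 × Fin 3) ⊕ Fin 3 → ℤ) {k : ℕ} (hk : k < 9) : (Array.ofFn fun p : Fin 9 => foldW w p).getD k 0 = foldW w ⟨k, hk⟩ :=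
  getD_ofFn_lt _ _ hk

/-- The folded half-width array is nonnegative under the guard. [formal bookkeeping] -/
theorem wfA_nonneg {w : (Fin 3 × Fin 3) ⊕ Fin 3 → ℤ} (hw : ∀ p : Fin 9, 0 < foldW w p) (k : ℕ) : 0 ≤ (Array.ofFn fun p : Fin 9 => foldW w p).getD k 0 := by
  by_cases hk : k < 9
  · rw [wfA_getD w hk]; exact (hw ⟨k, hk⟩).le
  · rw [getD_ofFn_ge _ _ (not_lt.1 hk)]

/-- The folded half-width array is bounded by the bound on the folded half-widths. [formal bookkeeping] -/
theorem wfA_le {w : (Fin 3 × Fin 3) ⊕ Fin 3 → ℤ} {M : ℤ} (hM : 0 ≤ M) (hw : ∀ p : Fin 9, foldW w p ≤ M) (k : ℕ) :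
    (Array.ofFn fun p : Fin 9 => foldW w p).getD k 0 ≤ M := by
  by_cases hk : k < 9
  · rw [wfA_getD w hk]; exact hw ⟨k, hk⟩
  · rw [getD_ofFn_ge _ _ (not_lt.1 hk)]; exact hM

/-- Under `foldGuard` every box half-width is nonnegative (entries). [formal bookkeeping] -/
theorem w_inl_nonneg {w : (Fin 3 × Fin 3) ⊕ Fin 3 → ℤ} (hw : ∀ p : Fin 9, 0 < foldW w p) (ab : Fin 3 × Fin 3) : (0 : ℝ) ≤ w (Sum.inl ab) := by
  have h0 := hw ⟨0, by norm_num⟩; have h1 := hw ⟨1, by norm_num⟩; have h2 := hw ⟨2, by norm_num⟩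
  have h3 := hw ⟨3, by norm_num⟩; have h4 := hw ⟨4, by norm_num⟩; have h5 := hw ⟨5, by norm_num⟩
  simp only [foldW] at h0 h1 h2 h3 h4 h5
  norm_num at h0 h1 h2 h3 h4 h5
  obtain ⟨a, b⟩ := ab
  fin_cases a <;> fin_cases b
  · exact_mod_cast h0.le
  · exact_mod_cast h3.1.le
  · exact_mod_cast h4.1.le
  · exact_mod_cast h3.2.le
  · exact_mod_cast h1.le
  · exact_mod_cast h5.1.le
  · exact_mod_cast h4.2.le
  · exact_mod_cast h5.2.le
  · exact_mod_cast h2.le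

/-- Under `foldGuard` every box half-width is nonnegative (shuffles). [formal bookkeeping] -/
theorem w_inr_nonneg {w : (Fin 3 × Fin 3) ⊕ Fin 3 → ℤ} (hw : ∀ p : Fin 9, 0 < foldW w p) (i : Fin 3) : (0 : ℝ) ≤ w (Sum.inr i) := by
  have h6 := hw ⟨6, by norm_num⟩; have h7 := hw ⟨7, by norm_num⟩; have h8 := hw ⟨8, by norm_num⟩
  simp only [foldW] at h6 h7 h8
  norm_num at h6 h7 h8
  fin_cases i
  · exact_mod_cast h6.le
  · exact_mod_cast h7.le
  · exact_mod_cast h8.le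

/-- The centre pair lies in its own box. [formal bookkeeping] -/
theorem cen_in_box {c w : (Fin 3 × Fin 3) ⊕ Fin 3 → ℤ} (hw : ∀ p : Fin 9, 0 < foldW w p) :
    (∀ ab : Fin 3 × Fin 3, |(cenMap c (EuclideanSpace.single ab.2 (1 : ℝ))) ab.1 - (c (Sum.inl ab) : ℝ) / SC| ≤ (w (Sum.inl ab) : ℝ) / SC) ∧
    (∀ i : Fin 3, |cenShuf c i - (c (Sum.inr i) : ℝ) / SC| ≤ (w (Sum.inr i) : ℝ) / SC) := by
  constructor
  · intro ab
    have h := cenMap_box c ab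
    simp only [Int.cast_zero, zero_div] at h
    exact h.trans (div_nonneg (w_inl_nonneg hw ab) SC_pos.le)
  · intro i
    have h := cenShuf_box c i
    simp only [zW, Int.cast_zero, zero_div] at h
    exact h.trans (div_nonneg (w_inr_nonneg hw i) SC_pos.le)

/-! ## §3. ★ Per-label point memberships in the kit's point tables -/

/-- ★ **`A`-family point memberships**: the masked gradient entry `[k<6]·βζ_k` and Hessian entry `[k,l<6]·(αζ_kζ_l + βν_kl)` of the label at the centre lie
in the point record's tables (centre radius off the junction radii). [folklore chaining] -/
theorem ptA_mem (c : (Fin 3 × Fin 3) ⊕ Fin 3 → ℤ) {b : Fin 3 → ℤ} {R : DRec} (hR : mkDRec 6 (cenE c) (pA b) = some R)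
    (hJ : ‖latPt (cenMap c) hexFrame b‖ ∉ junctions) :
    (∀ k, k < 9 → FI.mem (if k < 6 then deriv (effPot w₄₅ ω₄ (3 / 400)) ‖cenMap c (latPt (1 : E3 →L[ℝ] E3) hexFrame b)‖ /
        ‖cenMap c (latPt (1 : E3 →L[ℝ] E3) hexFrame b)‖ * zetaN (cenMap c) (latPt (1 : E3 →L[ℝ] E3) hexFrame b) k else 0)
        (if true ∧ 6 ≤ k then fi0 else R.co.be.mul (R.z k))) ∧
    (∀ k l, k < 9 → l < 9 → FI.mem (if k < 6 ∧ l < 6 then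
        (deriv (deriv (effPot w₄₅ ω₄ (3 / 400))) ‖cenMap c (latPt (1 : E3 →L[ℝ] E3) hexFrame b)‖ -
              deriv (effPot w₄₅ ω₄ (3 / 400)) ‖cenMap c (latPt (1 : E3 →L[ℝ] E3) hexFrame b)‖ / ‖cenMap c (latPt (1 : E3 →L[ℝ] E3) hexFrame b)‖) /
              ‖cenMap c (latPt (1 : E3 →L[ℝ] E3) hexFrame b)‖ ^ 2 *
            (zetaN (cenMap c) (latPt (1 : E3 →L[ℝ] E3) hexFrame b) k * zetaN (cenMap c) (latPt (1 : E3 →L[ℝ] E3) hexFrame b) l) +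
          deriv (effPot w₄₅ ω₄ (3 / 400)) ‖cenMap c (latPt (1 : E3 →L[ℝ] E3) hexFrame b)‖ / ‖cenMap c (latPt (1 : E3 →L[ℝ] E3) hexFrame b)‖ *
            nuR (cenMap c) (latPt (1 : E3 →L[ℝ] E3) hexFrame b) k l else 0) ((hessOf R true).getD (9 * k + l) fi0)) := by
  have hpos := norm_pos_of_mkDRec hR (cenMap c) (latPt (1 : E3 →L[ℝ] E3) hexFrame b) (mem_cenE c) (mem_pA b)
  have hJ' : ‖cenMap c (latPt (1 : E3 →L[ℝ] E3) hexFrame b)‖ ∉ junctions := by rw [← latPt_eq_apply_one]; exact hJ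
  obtain ⟨mal, mbe⟩ := mem_coefL hpos hJ' (mem_labelQ _ _ (mem_cenE c) (mem_pA b)) (mkDRec_coefL hR)
  obtain ⟨_, _, hζ, hν⟩ := mem_mkDRec (by norm_num : 6 ≤ 9) hR (cenMap c) (latPt (1 : E3 →L[ℝ] E3) hexFrame b) (mem_cenE c) (mem_pA b)
  constructor
  · intro k hk
    by_cases hk6 : k < 6
    · rw [if_pos hk6, if_neg (by rintro ⟨_, h⟩; omega)]
      exact FI.mem_mul mbe (hζ k hk6)
    · rw [if_neg hk6, if_pos ⟨rfl, by omega⟩]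
      exact mem_fi0
  · intro k l hk hl
    by_cases hkl : k < 6 ∧ l < 6
    · rw [if_pos hkl]
      exact mem_hessOf (by norm_num : 6 ≤ 9) (fun _ => le_rfl) mal mbe hζ hν (nuR_symm _ _) hkl.1 hkl.2
    · rw [if_neg hkl, hessOf_masked R hk hl (by omega)]
      exact mem_fi0

/-- ★ **`B`-family point memberships**: the gradient entry `βζ_k` and the Hessian entry `αζ_kζ_l + βν_kl` lie in the point record's tables. [folklore chaining] -/
theorem ptB_mem (c : (Fin 3 × Fin 3) ⊕ Fin 3 → ℤ) {b : Fin 3 → ℤ} {R : DRec} (hR : mkDRec 9 (cenE c) (qB (cenX c) b) = some R)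
    (hJ : ‖latPt (cenMap c) hexFrame b + cenMap c (hcpShift + cenShuf c)‖ ∉ junctions) :
    (∀ k, k < 9 → FI.mem (deriv (effPot w₄₅ ω₄ (3 / 400)) ‖cenMap c (latPt (1 : E3 →L[ℝ] E3) hexFrame b + (hcpShift + cenShuf c))‖ /
        ‖cenMap c (latPt (1 : E3 →L[ℝ] E3) hexFrame b + (hcpShift + cenShuf c))‖ *
        zetaN (cenMap c) (latPt (1 : E3 →L[ℝ] E3) hexFrame b + (hcpShift + cenShuf c)) k) (if false ∧ 6 ≤ k then fi0 else R.co.be.mul (R.z k))) ∧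
    (∀ k l, k < 9 → l < 9 → FI.mem
        ((deriv (deriv (effPot w₄₅ ω₄ (3 / 400))) ‖cenMap c (latPt (1 : E3 →L[ℝ] E3) hexFrame b + (hcpShift + cenShuf c))‖ -
              deriv (effPot w₄₅ ω₄ (3 / 400)) ‖cenMap c (latPt (1 : E3 →L[ℝ] E3) hexFrame b + (hcpShift + cenShuf c))‖ /
                ‖cenMap c (latPt (1 : E3 →L[ℝ] E3) hexFrame b + (hcpShift + cenShuf c))‖) /
              ‖cenMap c (latPt (1 : E3 →L[ℝ] E3) hexFrame b + (hcpShift + cenShuf c))‖ ^ 2 *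
            (zetaN (cenMap c) (latPt (1 : E3 →L[ℝ] E3) hexFrame b + (hcpShift + cenShuf c)) k *
              zetaN (cenMap c) (latPt (1 : E3 →L[ℝ] E3) hexFrame b + (hcpShift + cenShuf c)) l) +
          deriv (effPot w₄₅ ω₄ (3 / 400)) ‖cenMap c (latPt (1 : E3 →L[ℝ] E3) hexFrame b + (hcpShift + cenShuf c))‖ /
              ‖cenMap c (latPt (1 : E3 →L[ℝ] E3) hexFrame b + (hcpShift + cenShuf c))‖ *
            nuR (cenMap c) (latPt (1 : E3 →L[ℝ] E3) hexFrame b + (hcpShift + cenShuf c)) k l)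
        ((hessOf R false).getD (9 * k + l) fi0)) := by
  have hpos := norm_pos_of_mkDRec hR (cenMap c) (latPt (1 : E3 →L[ℝ] E3) hexFrame b + (hcpShift + cenShuf c)) (mem_cenE c) (mem_qB_cen c b)
  have hJ' : ‖cenMap c (latPt (1 : E3 →L[ℝ] E3) hexFrame b + (hcpShift + cenShuf c))‖ ∉ junctions := by
    rw [map_add, ← latPt_eq_apply_one]; exact hJ
  obtain ⟨mal, mbe⟩ := mem_coefL hpos hJ' (mem_labelQ _ _ (mem_cenE c) (mem_qB_cen c b)) (mkDRec_coefL hR)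
  obtain ⟨_, _, hζ, hν⟩ := mem_mkDRec (le_rfl : 9 ≤ 9) hR (cenMap c) (latPt (1 : E3 →L[ℝ] E3) hexFrame b + (hcpShift + cenShuf c))
    (mem_cenE c) (mem_qB_cen c b)
  constructor
  · intro k hk
    rw [if_neg (by rintro ⟨h, _⟩; exact Bool.false_ne_true h)]
    exact FI.mem_mul mbe (hζ k hk)
  · intro k l hk hl
    exact mem_hessOf (le_rfl : 9 ≤ 9) (fun h => absurd h (by simp)) mal mbe hζ hν (nuR_symm _ _) hk hl

/-! ## §4. ★ The centre energy in near-label form -/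

/-- ★★ **VALUE AT THE CENTRE, NEAR-LABEL FORM**: `v/SC ≤ Σ_{A} W‖U_c p_b‖ + Σ_{B} W‖U_c(p_b + hcpShift + ξ_c)‖` over the near-label lists of the box.
[folklore chaining: `valueP_sound` + `boxSum*_eq_nearSum` at the centre] -/
theorem centre_energy_ge {μ : ℤ} {c w : (Fin 3 × Fin 3) ⊕ Fin 3 → ℤ} {v : ℤ} (hv : valueP μ c = some v) (hU1 : ‖cenMap c - 1‖ ≤ 1 / 4)
    (hw : ∀ p : Fin 9, 0 < foldW w p) :
    (v : ℝ) / SC ≤ (∑ b ∈ (nearA c w).toFinset, effPot w₄₅ ω₄ (3 / 400) ‖cenMap c (latPt (1 : E3 →L[ℝ] E3) hexFrame b)‖) +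
      ∑ b ∈ (nearB c w).toFinset, effPot w₄₅ ω₄ (3 / 400) ‖cenMap c (latPt (1 : E3 →L[ℝ] E3) hexFrame b + (hcpShift + cenShuf c))‖ := by
  have h := valueP_sound hv hU1
  obtain ⟨hb, hx⟩ := cen_in_box (c := c) hw
  rw [boxSumA_eq_nearSum (cenMap c) hb, boxSumB_eq_nearSum (cenMap c) hb (cenShuf c) hx] at h
  have eA : ∀ b : Fin 3 → ℤ, latPt (cenMap c) hexFrame b = cenMap c (latPt (1 : E3 →L[ℝ] E3) hexFrame b) := fun b => latPt_eq_apply_one _ _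
  have eB : ∀ b : Fin 3 → ℤ, cenMap c (latPt (1 : E3 →L[ℝ] E3) hexFrame b) + cenMap c (hcpShift + cenShuf c) =
      cenMap c (latPt (1 : E3 →L[ℝ] E3) hexFrame b + (hcpShift + cenShuf c)) := fun b => by rw [← map_add]
  simp only [eA] at h
  simp only [eB] at h
  exact h

end Summit.AtomisticToContinuum.Crystallization.Theorems.FrustratedLawDichotomyStrainedPatchHomValueT2Kit
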